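import Mathlib
import Literature.Analysis.FluidPDE.Tao2016AveragedNS.BoundedEternalSolutions
import Literature.Analysis.FluidPDE.Tao2016AveragedNS.CascadeTableDictionary
import Summits.NavierStokesRegularity.NavierStokesRegularity.Theorems.TransitMassLedgerLedgerRigidityEnergy
import HarnessLib

/-!
# Critical variables for admissible eternal solutions: the renormalised lattice as an AUTONOMOUS
# lattice in physical time, the action as an L¹ norm, and RE-CENTRING of the blow-up time
# (support for `WakeRatchet.AdmissibleEternalBound`, stmt-NavierStokesRegularity-23197)

MODEL lattice ODEs only (Tao 2016 §4, §6.4); nothing in this file is a statement about the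
Navier–Stokes equations, and no summit or rung is proved by it.

For an admissible inviscid eternal solution `W` (`IsEternal ε₀ α W`) put `t = -e^{-σ} < 0` and
`V_n(t) := e^{σ} W_n(σ) = (-t)⁻¹ W_n(-log(-t))` (`= Λ^n X_n(t)` in Tao's physical variables, blow-up
time `t⋆ = 0`).  Then

* `hasDerivAt_crit`: `V̇_n = Q(V_n) + Λ A(V_{n-1}) + Λ⁻¹ B(V_{n+1}, V_n)` on `t < 0` — an AUTONOMOUS,
  shell-homogeneous quadratic lattice (the damping `-W` and the clock `e^{-σ}` are absorbed; uses the
  homogeneity `tableQ_smul`, `tableA_smul`, `tableB_smul_smul`; continuity from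
  `TransitMassLedgerEnergy.continuous_tableQ/A` and `continuous_tableB`);
* `integral_crit_eq`: `∫_{t<0} ‖V_n(t)‖ dt = ∫ ‖W_n(σ)‖ dσ` (the Jacobian cancels exactly), so the
  admissibility clause «action ≤ M» is a uniform L¹ bound in physical time, and `UniformBound W` reads
  `‖V_n(t)‖ ≤ C/|t|`;
* `isEternal_recentre`: conversely, ANY shell-wise solution `U` of the autonomous lattice on `t < 1`
  with `∫_{t<1}‖U_n‖ ≤ M` and `U_n` bounded near `1⁻` gives the admissible eternal solution
  `W'_n(σ) = e^{-σ} U_n(1 - e^{-σ})` — the renormalisation RE-CENTRED at the blow-up time `t⋆ = 1`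
  (`integrable_recentre_iff` is the change of variables).

The renormalisation centre is invisible in the critical variables; moving it past a time at which
`sup_n ‖V_n‖ = ∞` destroys `UniformBound` while keeping admissibility — the mechanism behind the
negative lemma `WakeRatchetAdmissibleEternalBound/Negative/AdmissibleEternalBoundFalseOfSymmetricBounceWaves`.
-/

noncomputable section

set_option linter.dupNamespace false

namespace Summit.NavierStokesRegularity.NavierStokesRegularity.Theorems

namespace WakeRatchetCritical

open Filter Topology MeasureTheory Set
open scoped RealInnerProductSpace
open Literature.Analysis.FluidPDE Literature.Analysis.FluidPDE.TaoCascade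

variable {m : ℕ}

/-! ## Homogeneity and continuity of the table maps -/

/-- The coordinate forms are bilinear: `qform(c•y, d•x) = c d · qform(y, x)`.
[cite: Tao2016AveragedNS, §4 (4.1), Lemma 4.1 (4.8)] -/
theorem qform_smul_smul (α : Fin m → Fin m → Fin m → ℤ × ℤ × ℤ → ℝ) (μ : ℤ × ℤ × ℤ) (c d : ℝ)
    (y x : Em m) (i : Fin m) : qform α μ (c • y) (d • x) i = c * d * qform α μ y x i := by
  unfold qform
  simp only [PiLp.smul_apply, smul_eq_mul, Finset.mul_sum]
  exact Finset.sum_congr rfl fun i₁ _ => Finset.sum_congr rfl fun i₂ _ => by ring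

/-- `Q` is homogeneous of degree two. [cite: Tao2016AveragedNS, §4 (4.1), Lemma 4.1 (4.8)] -/
theorem tableQ_smul (α : Fin m → Fin m → Fin m → ℤ × ℤ × ℤ → ℝ) (c : ℝ) (x : Em m) :
    tableQ α (c • x) = c ^ 2 • tableQ α x := by
  unfold tableQ
  rw [Finset.smul_sum]
  refine Finset.sum_congr rfl fun i _ => ?_
  rw [qform_smul_smul, smul_smul, sq]

/-- `A` is homogeneous of degree two. [cite: Tao2016AveragedNS, §4 (4.1), Lemma 4.1 (4.8)] -/
theorem tableA_smul (α : Fin m → Fin m → Fin m → ℤ × ℤ × ℤ → ℝ) (c : ℝ) (x : Em m) :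
    tableA α (c • x) = c ^ 2 • tableA α x := by
  unfold tableA
  rw [Finset.smul_sum]
  refine Finset.sum_congr rfl fun i _ => ?_
  rw [qform_smul_smul, smul_smul, sq]

/-- `B` is bilinear. [cite: Tao2016AveragedNS, §4 (4.1), Lemma 4.1 (4.8)] -/
theorem tableB_smul_smul (α : Fin m → Fin m → Fin m → ℤ × ℤ × ℤ → ℝ) (c d : ℝ) (y x : Em m) :
    tableB α (c • y) (d • x) = (c * d) • tableB α y x := by
  unfold tableB
  rw [Finset.smul_sum]
  refine Finset.sum_congr rfl fun i _ => ?_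
  rw [qform_smul_smul, qform_smul_smul, smul_smul, mul_comm d c, mul_add]

/-- `B` is jointly continuous (`Q`, `A`: `TransitMassLedgerEnergy.continuous_tableQ/A`).
[cite: Tao2016AveragedNS, §4 (4.1)] -/
theorem continuous_tableB (α : Fin m → Fin m → Fin m → ℤ × ℤ × ℤ → ℝ) :
    Continuous (fun p : Em m × Em m => tableB α p.1 p.2) := by
  unfold tableB qform; fun_prop

/-! ## Critical variables: `V_n(t) = (-t)⁻¹ W_n(-log(-t))` solves the autonomous lattice on `t < 0` -/

/-- The inner time map `t ↦ -log(-t)` has derivative `(-t)⁻¹` on `t < 0`. [folklore] -/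
theorem hasDerivAt_negLogNeg {t : ℝ} (ht : t < 0) :
    HasDerivAt (fun s : ℝ => -Real.log (-s)) ((-t)⁻¹) t := by
  have h1 : HasDerivAt (fun s : ℝ => -s) (-1) t := (hasDerivAt_id t).neg
  have h2 : HasDerivAt (fun s : ℝ => Real.log (-s)) ((-1) / (-t)) t := h1.log (by linarith)
  refine h2.neg.congr_deriv ?_
  have ht0 : (-t) ≠ 0 := by linarith
  field_simp

/-- The amplitude map `t ↦ (-t)⁻¹` has derivative `(-t)⁻¹ ^ 2` on `t < 0`. [folklore] -/
theorem hasDerivAt_invNeg {t : ℝ} (ht : t < 0) :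
    HasDerivAt (fun s : ℝ => (-s)⁻¹) ((-t)⁻¹ ^ 2) t := by
  have h1 : HasDerivAt (fun s : ℝ => -s) (-1) t := (hasDerivAt_id t).neg
  have h2 := h1.inv (by linarith : (-t) ≠ 0)
  refine h2.congr_deriv ?_
  have ht0 : (-t) ≠ 0 := by linarith
  field_simp

/-- **Critical variables.**  If shell `n` of `W` obeys the renormalised inviscid lattice law at the
log-time `σ = -log(-t)` (`t < 0`), then `V_k(t) := (-t)⁻¹ • W_k(-log(-t))` obeys the AUTONOMOUS
lattice `V̇_n = Q(V_n) + Λ A(V_{n-1}) + Λ⁻¹ B(V_{n+1}, V_n)` at `t` (the damping `-W` and the clock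
are absorbed; `V_n = Λ^n X_n` in Tao's physical variables with blow-up time `0`).
[cite: Tao2016AveragedNS, §4 Lemma 4.1 (4.8) and §6.4 (self-similar variables); cell vocabulary (`IsEternal`)] -/
theorem hasDerivAt_crit {ε₀ : ℝ} {α : Fin m → Fin m → Fin m → ℤ × ℤ × ℤ → ℝ}
    {W : ℤ → ℝ → Em m} {n : ℤ} {t : ℝ} (ht : t < 0)
    (hlaw : HasDerivAt (W n)
      (-((1 : ℝ) • W n (-Real.log (-t))) + tableQ α (W n (-Real.log (-t)))
        + bigLam ε₀ • tableA α (W (n - 1) (-Real.log (-t)))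
        + (bigLam ε₀)⁻¹ • tableB α (W (n + 1) (-Real.log (-t))) (W n (-Real.log (-t))))
      (-Real.log (-t))) :
    HasDerivAt (fun s : ℝ => (-s)⁻¹ • W n (-Real.log (-s)))
      (tableQ α ((-t)⁻¹ • W n (-Real.log (-t)))
        + bigLam ε₀ • tableA α ((-t)⁻¹ • W (n - 1) (-Real.log (-t)))
        + (bigLam ε₀)⁻¹ • tableB α ((-t)⁻¹ • W (n + 1) (-Real.log (-t)))
            ((-t)⁻¹ • W n (-Real.log (-t)))) t := by
  have hcomp := hlaw.scomp t (hasDerivAt_negLogNeg ht)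
  have hprod := (hasDerivAt_invNeg ht).smul hcomp
  refine hprod.congr_deriv ?_
  simp only [Function.comp_apply, tableQ_smul, tableA_smul, tableB_smul_smul, smul_add, smul_neg,
    smul_smul, one_smul]
  module

/-- The image of `σ ↦ c - e^{-σ}` is the half-line `(-∞, c)`. [folklore] -/
theorem image_sub_exp_neg (c : ℝ) : (fun σ : ℝ => c - Real.exp (-σ)) '' univ = Iio c := by
  ext t
  constructor
  · rintro ⟨σ, -, rfl⟩
    exact sub_lt_self _ (Real.exp_pos _)
  · intro ht
    refine ⟨-Real.log (c - t), mem_univ _, ?_⟩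
    simp only [neg_neg, Real.exp_log (sub_pos.2 ht), sub_sub_cancel]

/-- `σ ↦ c - e^{-σ}` has derivative `e^{-σ}`. [folklore] -/
theorem hasDerivAt_sub_exp_neg (c σ : ℝ) :
    HasDerivAt (fun s : ℝ => c - Real.exp (-s)) (Real.exp (-σ)) σ := by
  have h1 : HasDerivAt (fun s : ℝ => Real.exp (-s)) (Real.exp (-σ) * (-1)) σ :=
    (Real.hasDerivAt_exp (-σ)).comp σ ((hasDerivAt_id σ).neg)
  exact (h1.const_sub c).congr_deriv (by ring)

/-- **Change of variables for the action.**  For any `U : ℝ → E` and any centre `c`: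
`σ ↦ e^{-σ} U(c - e^{-σ})` is integrable on `ℝ` iff `U` is integrable on `(-∞, c)`, and then
`∫ ‖e^{-σ} U(c - e^{-σ})‖ dσ = ∫_{t < c} ‖U(t)‖ dt` (the Jacobian of `t = c - e^{-σ}` is `e^{-σ}`).
[folklore (change of variables); cell vocabulary (action of `IsEternal`)] -/
theorem integrable_recentre_iff {E : Type*} [NormedAddCommGroup E] [NormedSpace ℝ E]
    (U : ℝ → E) (c : ℝ) :
    (Integrable (fun σ : ℝ => ‖Real.exp (-σ) • U (c - Real.exp (-σ))‖)
      ↔ IntegrableOn (fun t => ‖U t‖) (Iio c)) ∧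
    (IntegrableOn (fun t => ‖U t‖) (Iio c) →
      ∫ σ, ‖Real.exp (-σ) • U (c - Real.exp (-σ))‖ = ∫ t in Iio c, ‖U t‖) := by
  have hderiv : ∀ σ ∈ (univ : Set ℝ), HasDerivWithinAt (fun s : ℝ => c - Real.exp (-s))
      (Real.exp (-σ)) univ σ := fun σ _ => (hasDerivAt_sub_exp_neg c σ).hasDerivWithinAt
  have hinj : InjOn (fun s : ℝ => c - Real.exp (-s)) univ := by
    intro x _ y _ hxy
    have : Real.exp (-x) = Real.exp (-y) := by
      have := hxy; dsimp at this; linarith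
    have := Real.exp_injective this
    linarith
  have hpt : ∀ σ : ℝ, |Real.exp (-σ)| • ‖U (c - Real.exp (-σ))‖
      = ‖Real.exp (-σ) • U (c - Real.exp (-σ))‖ := fun σ => by
    rw [norm_smul, Real.norm_eq_abs, smul_eq_mul]
  constructor
  · have key := integrableOn_image_iff_integrableOn_abs_deriv_smul MeasurableSet.univ hderiv hinj
      (fun t => ‖U t‖)
    rw [image_sub_exp_neg, integrableOn_univ] at key
    rw [key]
    exact integrable_congr (Filter.Eventually.of_forall fun σ => (hpt σ).symm)
  · intro _
    have key := integral_image_eq_integral_abs_deriv_smul MeasurableSet.univ hderiv hinj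
      (fun t => ‖U t‖)
    rw [image_sub_exp_neg, setIntegral_univ] at key
    rw [key]
    exact integral_congr_ae (Filter.Eventually.of_forall fun σ => (hpt σ).symm)

/-- **The action in critical variables.**  With `V_n(t) = (-t)⁻¹ • W_n(-log(-t))`:
`σ ↦ ‖W_n(σ)‖` is integrable iff `t ↦ ‖V_n(t)‖` is integrable on `(-∞,0)`, with equal integrals.
[cite: Tao2016AveragedNS, §6.4 (self-similar variables); cell vocabulary (action of `IsEternal`)] -/
theorem integral_crit_eq {E : Type*} [NormedAddCommGroup E] [NormedSpace ℝ E] (w : ℝ → E) :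
    (Integrable (fun σ : ℝ => ‖w σ‖)
      ↔ IntegrableOn (fun t : ℝ => ‖(-t)⁻¹ • w (-Real.log (-t))‖) (Iio 0)) ∧
    (Integrable (fun σ : ℝ => ‖w σ‖) →
      ∫ t in Iio (0 : ℝ), ‖(-t)⁻¹ • w (-Real.log (-t))‖ = ∫ σ, ‖w σ‖) := by
  have h := integrable_recentre_iff (fun t : ℝ => (-t)⁻¹ • w (-Real.log (-t))) 0
  have hpt : ∀ σ : ℝ, Real.exp (-σ) • ((-(0 - Real.exp (-σ)))⁻¹ • w (-Real.log (-(0 - Real.exp (-σ)))))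
      = w σ := fun σ => by
    rw [zero_sub, neg_neg, Real.log_exp, neg_neg, smul_smul,
      mul_inv_cancel₀ (Real.exp_pos _).ne', one_smul]
  simp only [hpt] at h
  exact ⟨h.1, fun hw => (h.2 (h.1.1 hw)).symm⟩

/-! ## Re-centring: a shell-wise solution on `t < 1` with integrable shells is an admissible eternal
solution for the blow-up time `t⋆ = 1` -/

/-- **Re-centring the renormalisation.**  Let `U : ℤ → ℝ → Em m` solve the autonomous lattice
`U̇_n = Q(U_n) + Λ A(U_{n-1}) + Λ⁻¹ B(U_{n+1}, U_n)` at every `t < 1`, with `∫_{t<1} ‖U_n‖ ≤ M` for all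
`n` and every `U_n` bounded on `[1/2, 1)`.  Then `W'_n(σ) := e^{-σ} • U_n(1 - e^{-σ})` is an admissible
inviscid eternal solution (`IsEternal`, blow-up time re-centred at `t⋆ = 1`).
[cite: Tao2016AveragedNS, §4 Lemma 4.1 (4.8), §6.4; cell vocabulary (`IsEternal`)] -/
theorem isEternal_recentre {ε₀ : ℝ} {α : Fin m → Fin m → Fin m → ℤ × ℤ × ℤ → ℝ}
    {U : ℤ → ℝ → Em m} {M : ℝ}
    (hU : ∀ (n : ℤ) (t : ℝ), t < 1 → HasDerivAt (U n)
      (tableQ α (U n t) + bigLam ε₀ • tableA α (U (n - 1) t)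
        + (bigLam ε₀)⁻¹ • tableB α (U (n + 1) t) (U n t)) t)
    (hint : ∀ n : ℤ, IntegrableOn (fun t => ‖U n t‖) (Iio 1) ∧ ∫ t in Iio 1, ‖U n t‖ ≤ M)
    (hbd : ∀ n : ℤ, ∃ P : ℝ, ∀ t : ℝ, 1 / 2 ≤ t → t < 1 → ‖U n t‖ ≤ P) :
    IsEternal ε₀ α (fun n σ => Real.exp (-σ) • U n (1 - Real.exp (-σ))) := by
  refine ⟨fun n σ => ?_, ⟨M, fun n => ?_⟩, fun n => ?_⟩
  · -- the law: chain rule through `t = 1 - e^{-σ}` and homogeneity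
    have hlt : 1 - Real.exp (-σ) < 1 := sub_lt_self _ (Real.exp_pos _)
    have hexp : HasDerivAt (fun s : ℝ => Real.exp (-s)) (-Real.exp (-σ)) σ := by
      have h1 : HasDerivAt (fun s : ℝ => Real.exp (-s)) (Real.exp (-σ) * (-1)) σ :=
        (Real.hasDerivAt_exp (-σ)).comp σ ((hasDerivAt_id σ).neg)
      convert h1 using 1; ring
    have hcomp := (hU n _ hlt).scomp σ (hasDerivAt_sub_exp_neg 1 σ)
    have hder := hexp.smul hcomp
    refine hder.congr_deriv ?_
    simp only [Function.comp_apply, tableQ_smul, tableA_smul, tableB_smul_smul, smul_add, smul_smul,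
      neg_smul]
    module
  · -- the action: change of variables
    have h := integrable_recentre_iff (U n) 1
    exact ⟨h.1.2 (hint n).1, by rw [h.2 (hint n).1]; exact (hint n).2⟩
  · -- the forward bound: `e^{2σ} ‖W'_n(σ)‖² = ‖U_n(1 - e^{-σ})‖²`, bounded for `σ ≥ log 2`
    obtain ⟨P, hP⟩ := hbd n
    refine ⟨Real.log 2, P ^ 2, fun σ hσ => ?_⟩
    have hle : Real.exp (-σ) ≤ 1 / 2 := by
      have h1 : Real.exp (-σ) ≤ Real.exp (-Real.log 2) := Real.exp_le_exp.2 (by linarith)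
      have h2 : Real.exp (-Real.log 2) = 1 / 2 := by
        rw [Real.exp_neg, Real.exp_log (by norm_num : (0:ℝ) < 2), one_div]
      linarith
    have ht1 : 1 / 2 ≤ 1 - Real.exp (-σ) := by linarith
    have ht2 : 1 - Real.exp (-σ) < 1 := sub_lt_self _ (Real.exp_pos _)
    have hPt := hP _ ht1 ht2
    have hP0 : 0 ≤ P := (norm_nonneg _).trans hPt
    have hw : Real.exp (2 * σ) * ‖Real.exp (-σ) • U n (1 - Real.exp (-σ))‖ ^ 2
        = ‖U n (1 - Real.exp (-σ))‖ ^ 2 := by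
      rw [norm_smul, Real.norm_eq_abs, abs_of_pos (Real.exp_pos _), mul_pow, ← mul_assoc,
        ← Real.exp_nat_mul, ← Real.exp_add]
      have : (2 : ℝ) * σ + ((2 : ℕ) : ℝ) * -σ = 0 := by push_cast; ring
      rw [this, Real.exp_zero, one_mul]
    rw [hw]
    exact pow_le_pow_left₀ (norm_nonneg _) hPt 2


/-! ## One-sided limits at the blow-up time -/

/-- `t ↦ -log(-t)` tends to `+∞` as `t → 0⁻`. [folklore] -/
theorem tendsto_negLogNeg_nhdsLT_zero :
    Tendsto (fun t : ℝ => -Real.log (-t)) (𝓝[<] (0 : ℝ)) atTop := by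
  have h1 : Tendsto (fun t : ℝ => -t) (𝓝[<] (0 : ℝ)) (𝓝[>] (0 : ℝ)) := by
    simpa using (tendsto_neg_nhdsLT (a := (0 : ℝ)))
  have h2 : Tendsto (fun t : ℝ => Real.log (-t)) (𝓝[<] (0 : ℝ)) atBot :=
    Real.tendsto_log_nhdsGT_zero.comp h1
  exact tendsto_neg_atBot_atTop.comp h2

/-- On `t < 0` the critical variable is `V(t) = e^{σ} W(σ)` at `σ = -log(-t)`. [folklore] -/
theorem crit_eq_exp_smul {E : Type*} [NormedAddCommGroup E] [NormedSpace ℝ E] (w : ℝ → E) {t : ℝ}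
    (ht : t < 0) :
    (-t)⁻¹ • w (-Real.log (-t)) = Real.exp (-Real.log (-t)) • w (-Real.log (-t)) := by
  rw [Real.exp_neg, Real.exp_log (neg_pos.2 ht)]

end WakeRatchetCritical

end Summit.NavierStokesRegularity.NavierStokesRegularity.Theorems
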